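import Literature.Analysis.FluidPDE.ForwardDSSLocalLerayEnergy
import Literature.Analysis.FluidPDE.ForwardDSSLocalLerayPressure
import Literature.Analysis.FluidPDE.WeakSpatialGradientSum
import Literature.Analysis.FluidPDE.NSSuitableESSProofs
import HarnessLib

/-!
# [BT1] §4: the enstrophy clause, and `bradshawTsai2017_section4` from the heat-flow claims

Analysis/FluidPDE proof file (theorems only) completing the discharge of the named fact
`Literature.Analysis.FluidPDE.bradshawTsai2017_section4` ([BT1] §4, the verification of the local
Leray axioms for an ansatz pair; `ForwardDSSLocalLeray`) modulo the heat-flow claims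
`bradshawTsai2017_caloric_localLeray` (`CaloricLocalLeray`):
`bradshawTsai2017_section4_of_caloric`, whence
`bradshawTsai2017_dss_localLeray_existence_of_thm_2_4 : bradshawTsai2017_thm_2_4 →
bradshawTsai2017_caloric_localLeray → bradshawTsai2017_dss_localLeray_existence` — the trust
base of [BT1] Thm 1.2 in the tree becomes {Thm 2.4 (with Lemma 3.4), the linear heat-flow
bounds}.

The remaining clause is the uniformly local enstrophy (`IsLocalLeraySolution.uniformLocalGradient`),
[BT1] §4: "`∫₀^{λ²}∫ |∇(v − e^{tΔ}v₀)|² ≲ (Σ_k λ^{-k}) ∫₁^{λ²}∫ |∇(v − e^{tΔ}v₀)|²`" plus "`e^{tΔ}v₀`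
has uniformly locally finite … enstrophy":

* (from `WeakSpatialGradientSum`) `HasWeakSpatialGradientOn.add`, `.congr_eqOn`: sum rule and
  irrelevance of values off `Q` for the tree's weak spatial gradients; `frobeniusNormSq_add_le`.
* `hasWeakSpatialGradientOn_dss_rescale`: for `w` `λ`-DSS on `t > 0` with weak gradient `G` on the
  slab, `λ² G(λ²t, λx)` is again one (`HasWeakSpatialGradientOn.stRescale`), hence equals `G` a.e.
  (`HasWeakSpatialGradientOn.ae_eq`); `setLIntegral_grad_step`:
  `∫∫_{(a/λ², b/λ²]×ℝ³} |G|² = λ⁻¹ ∫∫_{(a,b]×ℝ³} |G|²`; the shells below and above the period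
  (`setLIntegral_grad_shell_down/_up`) and `setLIntegral_grad_lt_top`:
  `∫∫_{(0,λ^{2M})×ℝ³} |∇(v − e^{tΔ}v₀)|² < ∞`.
* `IsAnsatzSolution.uniformLocalGradient`: `∇v = ∇(v − e^{tΔ}v₀) + ∇e^{tΔ}v₀` on the slab with
  `sup_{x₀} ∫₀^{R²}∫_{B_R(x₀)} |∇v|² ≤ 2∫∫_{(0,λ^{2M})×ℝ³} |∇(v − e^{tΔ}v₀)|² + 2C_H(R)`.

## References

* Z. Bradshaw, T.-P. Tsai, Ann. Henri Poincaré 18 (2017) = arXiv:1510.07504, §4 (proof of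
  Thm 1.2) [BradshawTsai2017AHP].
* L. C. Evans, *Partial differential equations*, §5.2.1 (weak derivatives) [Evans2010].
-/

noncomputable section

open MeasureTheory Set Function Filter Topology TopologicalSpace Metric Module
open scoped NNReal ENNReal InnerProductSpace RealInnerProductSpace

namespace Literature.Analysis.FluidPDE


namespace BradshawTsai2017

/-- Local notation for physical space `ℝ³ = EuclideanSpace ℝ (Fin 3)`. -/
local notation "ℝ³" => EuclideanSpace ℝ (Fin 3)

variable {c : ℝ} {v₀ : ℝ³ → ℝ³} {v : ℝ → ℝ³ → ℝ³} {π : ℝ → ℝ³ → ℝ}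

/-- The open slab `(0,∞) × ℝ³` is invariant under the parabolic scalings fixing the origin. [folklore] -/
theorem stPreimage_slab {β γ : ℝ} (hβ : 0 < β) :
    stPreimage β γ 0 (0 : ℝ³) (FluidPDE.slab ℝ³ (Ioi 0) isOpen_Ioi) =
      FluidPDE.slab ℝ³ (Ioi 0) isOpen_Ioi := by
  refine TopologicalSpace.Opens.ext (Set.ext fun z => ?_)
  simp only [coe_stPreimage, coe_slab, mem_preimage, mem_prod, mem_univ, and_true, stAffine_fst,
    mem_Ioi, zero_add]
  exact mul_pos_iff_of_pos_left hβ

/-- **DSS covariance of the weak gradient.** If `w` has the weak spatial gradient `G` on the slab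
and is `λ`-DSS there (`λ w(λ²t, λx) = w(t, x)`, `t > 0`), then the rescaled gradient
`λ² G(λ²t, λx)` is again a weak spatial gradient of `w` on the slab
(`HasWeakSpatialGradientOn.stRescale`). [cite: BradshawTsai2017AHP, §4 (proof of Thm 1.2)] -/
theorem hasWeakSpatialGradientOn_dss_rescale {w : ℝ → ℝ³ → ℝ³} {G : ℝ → ℝ³ → ℝ³ →L[ℝ] ℝ³}
    (hw : FluidPDE.HasWeakSpatialGradientOn (FluidPDE.slab ℝ³ (Ioi 0) isOpen_Ioi) w G)
    (hc : 0 < c) (hdss : ∀ t : ℝ, 0 < t → ∀ x : ℝ³, c • w (c ^ 2 * t) (c • x) = w t x) :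
    FluidPDE.HasWeakSpatialGradientOn (FluidPDE.slab ℝ³ (Ioi 0) isOpen_Ioi) w
      ((c * c) • stPull (c * c) c 0 (0 : ℝ³) G) := by
  have h1 := hw.stRescale c (mul_pos hc hc) hc 0 (0 : ℝ³)
  rw [stPreimage_slab (mul_pos hc hc)] at h1
  refine h1.congr_eqOn fun z hz => ?_
  obtain ⟨t, x⟩ := z
  have ht : 0 < t := by simpa using hz
  show w t x = (c • stPull (c * c) c 0 (0 : ℝ³) w) t x
  rw [smul_stPull_apply, zero_add, zero_add, ← sq]
  exact (hdss t ht x).symm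

/-- **One step down the scaling** for the dissipation of a `λ`-DSS field on the slab:
`∫∫_{(a/λ², b/λ²] × ℝ³} |G|² = λ⁻¹ ∫∫_{(a, b] × ℝ³} |G|²` for `0 ≤ a` (covariance, a.e. uniqueness of
weak gradients, and the change of variables). [cite: BradshawTsai2017AHP, §4 (proof of Thm 1.2)] -/
theorem setLIntegral_grad_step {w : ℝ → ℝ³ → ℝ³} {G : ℝ → ℝ³ → ℝ³ →L[ℝ] ℝ³}
    (hw : FluidPDE.HasWeakSpatialGradientOn (FluidPDE.slab ℝ³ (Ioi 0) isOpen_Ioi) w G)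
    (hc : 0 < c) (hdss : ∀ t : ℝ, 0 < t → ∀ x : ℝ³, c • w (c ^ 2 * t) (c • x) = w t x)
    {a : ℝ} (ha : 0 ≤ a) (b : ℝ) :
    ∫⁻ z in Ioc (a / (c * c)) (b / (c * c)) ×ˢ (univ : Set ℝ³),
        ENNReal.ofReal (frobeniusNormSq (G z.1 z.2)) =
      ENNReal.ofReal c⁻¹ *
        ∫⁻ z in Ioc a b ×ˢ (univ : Set ℝ³), ENNReal.ofReal (frobeniusNormSq (G z.1 z.2)) := by
  set G' : ℝ → ℝ³ → ℝ³ →L[ℝ] ℝ³ := (c * c) • stPull (c * c) c 0 (0 : ℝ³) G with hG'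
  have hae := hw.ae_eq (hasWeakSpatialGradientOn_dss_rescale hw hc hdss)
  rw [coe_slab] at hae
  have hae' : ∀ᵐ z : ℝ × ℝ³ ∂volume, z ∈ Ioi (0 : ℝ) ×ˢ (univ : Set ℝ³) →
      ENNReal.ofReal (frobeniusNormSq (G z.1 z.2)) = ENNReal.ofReal (frobeniusNormSq (G' z.1 z.2)) := by
    filter_upwards [(ae_restrict_iff' (measurableSet_Ioi.prod MeasurableSet.univ)).1 hae]
      with z hz hzS
    rw [show G z.1 z.2 = G' z.1 z.2 from hz hzS]
  have hS : Ioc (a / (c * c)) (b / (c * c)) ×ˢ (univ : Set ℝ³) ⊆ Ioi (0 : ℝ) ×ˢ (univ : Set ℝ³) :=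
    prod_mono (fun t ht => lt_of_le_of_lt (by positivity) ht.1) Subset.rfl
  calc ∫⁻ z in Ioc (a / (c * c)) (b / (c * c)) ×ˢ (univ : Set ℝ³),
        ENNReal.ofReal (frobeniusNormSq (G z.1 z.2))
      = ∫⁻ z in Ioc (a / (c * c)) (b / (c * c)) ×ˢ (univ : Set ℝ³),
          ENNReal.ofReal (frobeniusNormSq (G' z.1 z.2)) :=
        setLIntegral_congr_of_ae_imp (measurableSet_Ioc.prod MeasurableSet.univ) hS hae'
    _ = ∫⁻ z in stAffine (c * c) c 0 (0 : ℝ³) ⁻¹' (Ioc a b ×ˢ (univ : Set ℝ³)),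
          ENNReal.ofReal (frobeniusNormSq (G' z.1 z.2)) := by
        rw [stAffine_preimage_Ioc_prod (mul_pos hc hc), preimage_univ]
    _ = ENNReal.ofReal ((c * c) ^ 2) * ENNReal.ofReal (c * c * c ^ finrank ℝ ℝ³)⁻¹ *
          ∫⁻ z in Ioc a b ×ˢ (univ : Set ℝ³), ENNReal.ofReal (frobeniusNormSq (G z.1 z.2)) :=
        setLIntegral_frobeniusNormSq_stRescale (mul_pos hc hc) hc 0 (0 : ℝ³) (c * c) G _
    _ = ENNReal.ofReal c⁻¹ *
          ∫⁻ z in Ioc a b ×ˢ (univ : Set ℝ³), ENNReal.ofReal (frobeniusNormSq (G z.1 z.2)) := by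
        rw [finrank_euclideanSpace_fin, ← ENNReal.ofReal_mul (by positivity)]
        congr 2
        field_simp

/-- The dissipation on the shells below the period `(1, λ²]`:
`∫∫_{(λ^{-2(k+1)}, λ^{-2k}] × ℝ³} |G|² = λ^{-(k+1)} ∫∫_{(1, λ²] × ℝ³} |G|²`. [cite: BradshawTsai2017AHP, §4 (proof of Thm 1.2)] -/
theorem setLIntegral_grad_shell_down {w : ℝ → ℝ³ → ℝ³} {G : ℝ → ℝ³ → ℝ³ →L[ℝ] ℝ³}
    (hw : FluidPDE.HasWeakSpatialGradientOn (FluidPDE.slab ℝ³ (Ioi 0) isOpen_Ioi) w G)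
    (hc : 0 < c) (hdss : ∀ t : ℝ, 0 < t → ∀ x : ℝ³, c • w (c ^ 2 * t) (c • x) = w t x) (k : ℕ) :
    ∫⁻ z in Ioc ((c ^ 2) ^ (k + 1))⁻¹ ((c ^ 2) ^ k)⁻¹ ×ˢ (univ : Set ℝ³),
        ENNReal.ofReal (frobeniusNormSq (G z.1 z.2)) =
      ENNReal.ofReal c⁻¹ ^ (k + 1) *
        ∫⁻ z in Ioc 1 (c ^ 2) ×ˢ (univ : Set ℝ³), ENNReal.ofReal (frobeniusNormSq (G z.1 z.2)) := by
  induction k with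
  | zero =>
      have h := setLIntegral_grad_step hw hc hdss zero_le_one (c ^ 2)
      rw [one_div, ← sq, div_self (pow_ne_zero 2 hc.ne')] at h
      simpa using h
  | succ k ih =>
      have h := setLIntegral_grad_step hw hc hdss (inv_nonneg.2 (pow_nonneg (sq_nonneg c) (k + 1)))
        (((c ^ 2) ^ k)⁻¹)
      have e1 : ((c ^ 2) ^ (k + 1))⁻¹ / (c * c) = ((c ^ 2) ^ (k + 1 + 1))⁻¹ := by
        rw [← sq, div_eq_mul_inv, ← mul_inv, ← pow_succ]
      have e2 : ((c ^ 2) ^ k)⁻¹ / (c * c) = ((c ^ 2) ^ (k + 1))⁻¹ := by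
        rw [← sq, div_eq_mul_inv, ← mul_inv, ← pow_succ]
      rw [e1, e2] at h
      rw [h, ih, ← mul_assoc, ← pow_succ']

/-- The dissipation on the periods above `(1, λ²]`:
`∫∫_{(λ^{2m}, λ^{2(m+1)}] × ℝ³} |G|² = λ^{m} ∫∫_{(1, λ²] × ℝ³} |G|²`. [cite: BradshawTsai2017AHP, §4 (proof of Thm 1.2)] -/
theorem setLIntegral_grad_shell_up {w : ℝ → ℝ³ → ℝ³} {G : ℝ → ℝ³ → ℝ³ →L[ℝ] ℝ³}
    (hw : FluidPDE.HasWeakSpatialGradientOn (FluidPDE.slab ℝ³ (Ioi 0) isOpen_Ioi) w G)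
    (hc : 0 < c) (hdss : ∀ t : ℝ, 0 < t → ∀ x : ℝ³, c • w (c ^ 2 * t) (c • x) = w t x) (m : ℕ) :
    ∫⁻ z in Ioc ((c ^ 2) ^ m) ((c ^ 2) ^ (m + 1)) ×ˢ (univ : Set ℝ³),
        ENNReal.ofReal (frobeniusNormSq (G z.1 z.2)) =
      ENNReal.ofReal c ^ m *
        ∫⁻ z in Ioc 1 (c ^ 2) ×ˢ (univ : Set ℝ³), ENNReal.ofReal (frobeniusNormSq (G z.1 z.2)) := by
  induction m with
  | zero => simp
  | succ m ih =>
      -- one step down from `((c²)^(m+1), (c²)^(m+2)]` lands on `((c²)^m, (c²)^(m+1)]`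
      have h := setLIntegral_grad_step hw hc hdss (pow_nonneg (sq_nonneg c) (m + 1))
        ((c ^ 2) ^ (m + 1 + 1))
      have e1 : (c ^ 2) ^ (m + 1) / (c * c) = (c ^ 2) ^ m := by
        rw [← sq, pow_succ, mul_div_assoc, div_self (pow_ne_zero 2 hc.ne'), mul_one]
      have e2 : (c ^ 2) ^ (m + 1 + 1) / (c * c) = (c ^ 2) ^ (m + 1) := by
        rw [← sq, pow_succ, mul_div_assoc, div_self (pow_ne_zero 2 hc.ne'), mul_one]
      rw [e1, e2, ih] at h
      -- `h : c^m J = c⁻¹ I_{m+1}`; multiply by `c`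
      have hcc : ENNReal.ofReal c * ENNReal.ofReal c⁻¹ = 1 := by
        rw [← ENNReal.ofReal_mul hc.le, mul_inv_cancel₀ hc.ne', ENNReal.ofReal_one]
      calc ∫⁻ z in Ioc ((c ^ 2) ^ (m + 1)) ((c ^ 2) ^ (m + 1 + 1)) ×ˢ (univ : Set ℝ³),
            ENNReal.ofReal (frobeniusNormSq (G z.1 z.2))
          = ENNReal.ofReal c * (ENNReal.ofReal c⁻¹ *
              ∫⁻ z in Ioc ((c ^ 2) ^ (m + 1)) ((c ^ 2) ^ (m + 1 + 1)) ×ˢ (univ : Set ℝ³),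
                ENNReal.ofReal (frobeniusNormSq (G z.1 z.2))) := by
            rw [← mul_assoc, hcc, one_mul]
        _ = ENNReal.ofReal c ^ (m + 1) * ∫⁻ z in Ioc 1 (c ^ 2) ×ˢ (univ : Set ℝ³),
              ENNReal.ofReal (frobeniusNormSq (G z.1 z.2)) := by
            rw [← h, ← mul_assoc, ← pow_succ']

/-- **Global dissipation of `v − e^{tΔ}v₀` up to any time** ([BT1] §4, (4.1): "`v − e^{tΔ}v₀ ∈
L²(0,λ²;H¹(ℝ³))`", via "`∫₀^{λ²}∫ |∇(v − e^{tΔ}v₀)|² ≲ (Σ_k λ^{-k}) ∫₁^{λ²}∫ |∇(v − e^{tΔ}v₀)|²`"):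
for a `λ`-DSS field on the slab with weak gradient `G` square integrable on `(1,λ²) × ℝ³`,
`∫∫_{(0, λ^{2M}) × ℝ³} |G|² < ∞` for every `M ∈ ℕ`. [cite: BradshawTsai2017AHP, §4 (proof of Thm 1.2)] -/
theorem setLIntegral_grad_lt_top {w : ℝ → ℝ³ → ℝ³} {G : ℝ → ℝ³ → ℝ³ →L[ℝ] ℝ³}
    (hw : FluidPDE.HasWeakSpatialGradientOn (FluidPDE.slab ℝ³ (Ioi 0) isOpen_Ioi) w G)
    (hc : 1 < c) (hdss : ∀ t : ℝ, 0 < t → ∀ x : ℝ³, c • w (c ^ 2 * t) (c • x) = w t x)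
    (hfin : ∫⁻ z in Ioo 1 (c ^ 2) ×ˢ (univ : Set ℝ³), ENNReal.ofReal (frobeniusNormSq (G z.1 z.2)) < ⊤)
    (M : ℕ) :
    ∫⁻ z in Ioo 0 ((c ^ 2) ^ M) ×ˢ (univ : Set ℝ³), ENNReal.ofReal (frobeniusNormSq (G z.1 z.2)) < ⊤ := by
  have hc0 : 0 < c := zero_lt_one.trans hc
  set F : ℝ × ℝ³ → ℝ≥0∞ := fun z => ENNReal.ofReal (frobeniusNormSq (G z.1 z.2)) with hF
  -- the period `(1, λ²]`
  have hJ : ∫⁻ z in Ioc 1 (c ^ 2) ×ˢ (univ : Set ℝ³), F z < ⊤ := by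
    have hae : (Ioo (1 : ℝ) (c ^ 2) ×ˢ (univ : Set ℝ³) : Set (ℝ × ℝ³)) =ᵐ[volume]
        (Ioc (1 : ℝ) (c ^ 2) ×ˢ (univ : Set ℝ³) : Set (ℝ × ℝ³)) := by
      rw [Measure.volume_eq_prod]
      exact Measure.set_prod_ae_eq Ioo_ae_eq_Ioc EventuallyEq.rfl
    rw [← Measure.restrict_congr_set hae]
    exact hfin
  set J := ∫⁻ z in Ioc 1 (c ^ 2) ×ˢ (univ : Set ℝ³), F z with hJdef
  set r : ℝ≥0∞ := ENNReal.ofReal c⁻¹ with hr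
  have hr1 : r < 1 := by
    rw [hr, ← ENNReal.ofReal_one]
    exact (ENNReal.ofReal_lt_ofReal_iff zero_lt_one).2 (inv_lt_one_of_one_lt₀ hc)
  -- below the period
  have hdown : ∫⁻ z in Ioo 0 1 ×ˢ (univ : Set ℝ³), F z < ⊤ := by
    have hcover : Ioo (0 : ℝ) 1 ×ˢ (univ : Set ℝ³) ⊆
        ⋃ k : ℕ, Ioc ((c ^ 2) ^ (k + 1))⁻¹ ((c ^ 2) ^ k)⁻¹ ×ˢ (univ : Set ℝ³) := by
      rw [← iUnion_prod_const]
      exact prod_mono (Ioo_subset_iUnion_shell hc) Subset.rfl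
    calc ∫⁻ z in Ioo 0 1 ×ˢ (univ : Set ℝ³), F z
        ≤ ∫⁻ z in ⋃ k : ℕ, Ioc ((c ^ 2) ^ (k + 1))⁻¹ ((c ^ 2) ^ k)⁻¹ ×ˢ (univ : Set ℝ³), F z :=
          lintegral_mono_set hcover
      _ ≤ ∑' k : ℕ, ∫⁻ z in Ioc ((c ^ 2) ^ (k + 1))⁻¹ ((c ^ 2) ^ k)⁻¹ ×ˢ (univ : Set ℝ³), F z :=
          lintegral_iUnion_le _ _
      _ = ∑' k : ℕ, r ^ (k + 1) * J :=
          tsum_congr fun k => setLIntegral_grad_shell_down hw hc0 hdss k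
      _ ≤ ∑' k : ℕ, r ^ k * J := ENNReal.tsum_le_tsum fun k =>
          mul_le_mul_left (pow_le_pow_right_of_le_one' hr1.le (Nat.le_succ k)) _
      _ = (∑' k : ℕ, r ^ k) * J := ENNReal.tsum_mul_right
      _ < ⊤ := ENNReal.mul_lt_top (tsum_geometric_lt_top.2 hr1) hJ
  -- above the period, finitely many shells
  have hup : ∀ m : ℕ, ∫⁻ z in Ioc ((c ^ 2) ^ m) ((c ^ 2) ^ (m + 1)) ×ˢ (univ : Set ℝ³), F z < ⊤ :=
    fun m => by
      rw [setLIntegral_grad_shell_up hw hc0 hdss m]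
      exact ENNReal.mul_lt_top (ENNReal.pow_lt_top ENNReal.ofReal_lt_top) hJ
  -- induction on the number of periods above `(0, 1)`
  induction M with
  | zero => simpa using hdown
  | succ M ih =>
      have hcov : Ioo (0 : ℝ) ((c ^ 2) ^ (M + 1)) ×ˢ (univ : Set ℝ³) ⊆
          Ioo (0 : ℝ) ((c ^ 2) ^ M) ×ˢ (univ : Set ℝ³) ∪
            Icc ((c ^ 2) ^ M) ((c ^ 2) ^ (M + 1)) ×ˢ (univ : Set ℝ³) := by
        rintro ⟨t, x⟩ ⟨⟨ht0, htM⟩, -⟩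
        rcases lt_or_ge t ((c ^ 2) ^ M) with ht | ht
        · exact Or.inl ⟨⟨ht0, ht⟩, mem_univ _⟩
        · exact Or.inr ⟨⟨ht, htM.le⟩, mem_univ _⟩
      have hIcc : ∫⁻ z in Icc ((c ^ 2) ^ M) ((c ^ 2) ^ (M + 1)) ×ˢ (univ : Set ℝ³), F z =
          ∫⁻ z in Ioc ((c ^ 2) ^ M) ((c ^ 2) ^ (M + 1)) ×ˢ (univ : Set ℝ³), F z := by
        refine Measure.restrict_congr_set ?_ ▸ rfl
        rw [Measure.volume_eq_prod]
        exact Measure.set_prod_ae_eq Ioc_ae_eq_Icc EventuallyEq.rfl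
      refine lt_of_le_of_lt (lintegral_mono_set hcov) ?_
      refine lt_of_le_of_lt (lintegral_union_le _ _ _) ?_
      rw [hIcc]
      exact ENNReal.add_lt_top.2 ⟨ih, hup M⟩

/-- **The enstrophy clause** ([BT1] §4, "Locally finite energy and enstrophy"): `v` has the weak
spatial gradient `∇(v − e^{tΔ}v₀) + ∇e^{tΔ}v₀` on the slab, and for every `R > 0`,
`sup_{x₀} ∫₀^{R²}∫_{B_R(x₀)} |∇v|² ≤ 2∫₀^{λ^{2M}}∫_{ℝ³} |∇(v − e^{tΔ}v₀)|² + 2 C_H(R) < ∞`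
(`R² ≤ λ^{2M}`). [cite: BradshawTsai2017AHP, §4 (proof of Thm 1.2)] -/
theorem IsAnsatzSolution.uniformLocalGradient (h : IsAnsatzSolution c v₀ v π) (hc : 1 < c)
    (hv₀ : FluidPDE.nsRescaleData c v₀ = v₀)
    (hV : IsCaloricLocalLerayField v₀ (UnboundedOperators.heatExtension v₀)) :
    ∃ G : ℝ → ℝ³ → ℝ³ →L[ℝ] ℝ³,
      FluidPDE.HasWeakSpatialGradientOn (FluidPDE.slab ℝ³ (Ioi 0) isOpen_Ioi) v G ∧
      ∀ R : ℝ, 0 < R → ∃ C : ℝ≥0, ∀ x₀ : ℝ³,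
        ∫⁻ z in Ioo 0 (R ^ 2) ×ˢ ball x₀ R, ENNReal.ofReal (frobeniusNormSq (G z.1 z.2)) ≤ C := by
  have hc0 : 0 < c := zero_lt_one.trans hc
  obtain ⟨Gw, hGw, hGwfin⟩ := h.gradient_sub_heat
  obtain ⟨H, hH, hHb⟩ := hV.uniformLocalGradient
  have hsum := hGw.add hH
  have hfun : (fun t x => (v t x - UnboundedOperators.heatExtension v₀ t x) +
      UnboundedOperators.heatExtension v₀ t x) = v := by
    funext t x; exact sub_add_cancel _ _
  rw [hfun] at hsum
  refine ⟨fun t x => Gw t x + H t x, hsum, fun R hR => ?_⟩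
  -- the difference is `λ`-DSS on `t > 0`
  have hdss : ∀ t : ℝ, 0 < t → ∀ x : ℝ³,
      c • (fun t x => v t x - UnboundedOperators.heatExtension v₀ t x) (c ^ 2 * t) (c • x) =
        (fun t x => v t x - UnboundedOperators.heatExtension v₀ t x) t x := by
    intro t ht x
    have e := congrFun (congrFun h.dss t) x
    rw [FluidPDE.nsRescale_apply] at e
    simp only [smul_sub]
    rw [heatExtension_dss hc0 hv₀ ht, e]
  obtain ⟨M, hM⟩ := pow_unbounded_of_one_lt (R ^ 2) (one_lt_pow₀ hc two_ne_zero)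
  have hW := setLIntegral_grad_lt_top hGw hc hdss hGwfin M
  obtain ⟨C_H, hCH⟩ := hHb R hR
  set W := ∫⁻ z in Ioo 0 ((c ^ 2) ^ M) ×ˢ (univ : Set ℝ³),
    ENNReal.ofReal (frobeniusNormSq (Gw z.1 z.2)) with hWdef
  have htop : 2 * W + 2 * (C_H : ℝ≥0∞) ≠ ⊤ := ENNReal.add_ne_top.2
    ⟨ENNReal.mul_ne_top ENNReal.ofNat_ne_top hW.ne, ENNReal.mul_ne_top ENNReal.ofNat_ne_top
      ENNReal.coe_ne_top⟩
  refine ⟨(2 * W + 2 * (C_H : ℝ≥0∞)).toNNReal, fun x₀ => ?_⟩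
  rw [ENNReal.coe_toNNReal htop]
  have hHmeas : AEMeasurable (fun z : ℝ × ℝ³ => ENNReal.ofReal (frobeniusNormSq (H z.1 z.2)))
      (volume.restrict (Ioo 0 (R ^ 2) ×ˢ ball x₀ R)) := by
    have h1 : AEStronglyMeasurable (uncurry H) (volume.restrict (Ioo 0 (R ^ 2) ×ˢ ball x₀ R)) := by
      have h2 := hH.locallyIntegrableOn_grad.aestronglyMeasurable
      rw [coe_slab] at h2
      exact h2.mono_measure (Measure.restrict_mono (Set.prod_mono Ioo_subset_Ioi_self
        (subset_univ _)) le_rfl)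
    exact ENNReal.measurable_ofReal.comp_aemeasurable
      (LerayHopfProofs.continuous_frobeniusNormSq.measurable.comp_aemeasurable h1.aemeasurable)
  calc ∫⁻ z in Ioo 0 (R ^ 2) ×ˢ ball x₀ R, ENNReal.ofReal (frobeniusNormSq (Gw z.1 z.2 + H z.1 z.2))
      ≤ ∫⁻ z in Ioo 0 (R ^ 2) ×ˢ ball x₀ R, (2 * ENNReal.ofReal (frobeniusNormSq (Gw z.1 z.2)) +
          2 * ENNReal.ofReal (frobeniusNormSq (H z.1 z.2))) := by
        refine lintegral_mono fun z => ?_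
        calc ENNReal.ofReal (frobeniusNormSq (Gw z.1 z.2 + H z.1 z.2))
            ≤ ENNReal.ofReal (2 * frobeniusNormSq (Gw z.1 z.2) + 2 * frobeniusNormSq (H z.1 z.2)) :=
              ENNReal.ofReal_le_ofReal (frobeniusNormSq_add_le _ _)
          _ = _ := by
              rw [ENNReal.ofReal_add (by positivity [frobeniusNormSq_nonneg (Gw z.1 z.2)])
                (by positivity [frobeniusNormSq_nonneg (H z.1 z.2)]),
                ENNReal.ofReal_mul zero_le_two, ENNReal.ofReal_mul zero_le_two, ENNReal.ofReal_ofNat]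
    _ = 2 * (∫⁻ z in Ioo 0 (R ^ 2) ×ˢ ball x₀ R, ENNReal.ofReal (frobeniusNormSq (Gw z.1 z.2))) +
          2 * ∫⁻ z in Ioo 0 (R ^ 2) ×ˢ ball x₀ R, ENNReal.ofReal (frobeniusNormSq (H z.1 z.2)) := by
        rw [lintegral_add_right' _ (hHmeas.const_mul 2), lintegral_const_mul' _ _ ENNReal.ofNat_ne_top,
          lintegral_const_mul' _ _ ENNReal.ofNat_ne_top]
    _ ≤ 2 * W + 2 * (C_H : ℝ≥0∞) :=
        add_le_add (mul_le_mul_right (lintegral_mono_set (prod_mono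
          (Ioo_subset_Ioo le_rfl hM.le) (subset_univ _))) _) (mul_le_mul_right (hCH x₀) _)

end BradshawTsai2017

/-- Local notation for physical space `ℝ³ = EuclideanSpace ℝ (Fin 3)`. -/
local notation "ℝ³" => EuclideanSpace ℝ (Fin 3)

/-- **[BT1] §4 discharged modulo the heat-flow claims.** The verification of the local Leray
axioms (`bradshawTsai2017_section4`) follows from the linear local Leray bounds of the caloric
extension (`bradshawTsai2017_caloric_localLeray`): suitability is part of the ansatz pair; local
square integrability, uniformly local energy, attainment of the datum and decay at infinity are
`2|v − e^{tΔ}v₀|² + 2|e^{tΔ}v₀|²`-splittings against the `t^{1/4}`-law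
(`ForwardDSSLocalLerayEnergy`); the pressure class up to `t = 0` is the gap argument
(`ForwardDSSLocalLerayPressure`); the enstrophy is the DSS summation of the dissipation of
`v − e^{tΔ}v₀` plus that of the heat flow (this file). Hence the trust base of
`bradshawTsai2017_dss_localLeray_existence` is
`{bradshawTsai2017_thm_2_4, bradshawTsai2017_caloric_localLeray}`. [cite: BradshawTsai2017AHP, §4 (proof of Thm 1.2)] -/
theorem bradshawTsai2017_section4_of_caloric (hH : bradshawTsai2017_caloric_localLeray) :
    bradshawTsai2017_section4 := by
  intro c hc v₀ hw hdiv hdss v π h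
  have hV := hH hw
  exact
    { suitable := h.suitable
      sqIntegrable := fun T _ K hK => h.sqIntegrable hc hdss hV T hK
      pressure := fun T _ K hK => h.pressure hc T hK
      uniformLocalEnergy := fun R hR => by
        obtain ⟨C, hC⟩ := h.uniformLocalEnergy hc hdss hV hR
        exact ⟨C, (ae_restrict_iff' measurableSet_Ioo).2 (Eventually.of_forall fun t ht x₀ =>
          hC t ht x₀)⟩
      uniformLocalGradient := h.uniformLocalGradient hc hdss hV
      initial := fun K hK => h.initial hc hdss hw.aestronglyMeasurable hV hK
      decay := fun R hR => h.decay hc hdss hV hR }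

/-- **Assembly with the heat-flow claims**: Theorem 2.4 (with Lemma 3.4) and the linear local Leray
bounds of `e^{tΔ}v₀` imply [BT1] Theorem 1.2 as rendered. [cite: BradshawTsai2017AHP, §4 (proof of Thm 1.2)] -/
theorem bradshawTsai2017_dss_localLeray_existence_of_thm_2_4 (h24 : bradshawTsai2017_thm_2_4)
    (hH : bradshawTsai2017_caloric_localLeray) : bradshawTsai2017_dss_localLeray_existence :=
  bradshawTsai2017_dss_localLeray_existence_of_parts h24 (bradshawTsai2017_section4_of_caloric hH)

end Literature.Analysis.FluidPDE

end
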